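import Summits.BirchSwinnertonDyer.Rank1Residual.GaloisImage.KuriharaRecordBSDpThreeLevelOneEndNoRankEPC
import Summits.BirchSwinnertonDyer.Rank1Residual.GaloisImage.LocalThreeTorsionDecider
import Summits.BirchSwinnertonDyer.Rank1Residual.Additive.X4ThreeResCertKernel
import Summits.BirchSwinnertonDyer.Rank1Residual.Additive.JValuationOfIntModel
import Summits.BirchSwinnertonDyer.Rank1Residual.Additive.X4ThreeKuriharaCertRecordsS2_41
import Summits.BirchSwinnertonDyer.Rank1Residual.Additive.X4ThreeKuriharaCertRecordsS2_42
import HarnessLib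

/-!
# N11 LOWER@3: END-m1 RECORDS ([K25]-FREE, [S24]-FREE `BSD(E,3)` record shapes from ONE level-one Kurihara
# unit and two level-zero fields) for the (19.1) BLIND-A rows — file BlindA3: `20691e1`, `20808k1`
# (cell `b2b-bsdres`, team n1011, seat p03, OWNERS rows T-R1-57-REC (END-m1 record series, p03 lineage) and
# T-a2-REC; END theorems = the hEP-free / hr-free corollaries
# `GaloisImage/KuriharaRecordBSDpThreeLevelOneEndNoRankEPC.lean` (p302155) of n1011-p18's
# `…LevelOneEndOfBaseRigidity` ENDs over n1011-p09's END-m1 and n1011-p11's BASE RIGIDITY (R1-58);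
# sibling [K25]-conditional records `Additive/X4ThreeKuriharaCertRecordsS2_39..42.lean` at the SAME (row, n))

HONEST FRAMING (cell `b2b-bsdres`, run/shared/lean/b2b/bsd-rank1-residual/, verbatim in every
file): the goal of the cell is to DELETE the COMBINATION-SHAPED residual classes of the
Birch–Swinnerton-Dyer formula for ALL analytic-rank `≤ 1` elliptic curves over `ℚ` — "full BSD
formula for every rank `≤ 1` curve in class `C`" assembled STRICTLY from published theorems — so
that the rank-`≤ 1` remainder becomes exactly the CONSTRUCTION-SHAPED classes, which are TYPED
(missing-input `Prop`s), NOT attempted. This is not "finishing BSD". Team n1011 (N10/N11, the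
additive block `X4 ∧ p = 3`) is a RESEARCH ROUTE; no claim beyond the stated classes; the label X4 and
the mark of RESIDUAL-MAP §I N11 (LOWER@3) are UNCHANGED. **These records CLOSE NOTHING and move no
mark**: PER-PAIR record SHAPES, not a class theorem; EVIDENCE-grade booking CANDIDATES for the director,
nothing is booked by this file. END-m1 is DEBT REDUCTION, not coverage: `BSD(E,3)` only where
`ord₃(L(E,1)/Ω_E) ≤ 2`, CONDITIONAL on the UPPER-half facts of the X4 chain of record (`hKatoS hDel
hmodD hKatoχ`; `hGZK hmod h26`), Cassels–Tate (`hCT`), the Poitou–Tate family at `3` (`inv hperf hsum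
hcompl` — NO `hunro`: base rigidity), the ONE port `KatoKuriharaPortThreeAt W 0 v₃`
(FLAG `K22-Thm3.13-PORT@3`); NO [S24] fact, NO `hr` (implied by the level-zero unit), NO `hEP`
(Tate's local Euler–Poincaré characteristic is the tree theorem p300886). The three Kurihara VALUES in
`hδ` are HYPOTHESES labelled EVIDENCE (provenance per record: the census pass-52 WORD at (row, n) verbatim; the lead's R5-84 (c) provenance sentence at level one). Theorems only (no definition,
no named fact minted).

## What this file does

For each row `E` below — Cremona's minimal model read off ecdata (`allcurves`/`allbsd`/`opt_man`
.20000-29999; seat register `b2b-bsdres-n1011-p03/g10/blindA/curves_blindA8.tsv`); `N = 3²·M` with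
`2·10⁴ ≤ N < 2.1·10⁴` (just above the E2-AT3 STAGE-2 window), ADDITIVE at `3`; class A1 (surj(3),
`E(ℚ₃)[3] = 0`), `r_an = 0`, UNIT (`3 ∤ ∏ c_ℓ`), `#Ш_an = 9`; one of the seven (19.1) BLIND-A rows of
cc-eng-3's kit j139776 with `#E(ℚ₃)[3] = 1` (the eighth, `20727r1`, has `#E(ℚ₃)[3] = 3` and is NOT an
END-m1 row), EACH of which carries p03's landed [K25]-conditional record `bsdp3_kur_v<label>` AT THE SAME
`(row, n)` — the record `bsdp3_endm1_v<label>` (`integralModelInt` currency) and its LITERAL-model twin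
`…_of_eq` : `BSDp W 3` by `Assembly.bsdp_three_potMult_of_levelOneCertificates_of_baseRigidity_noRank_noEP`
on the potentially MULTIPLICATIVE rows (`ord₃ j < 0` read off the model, `3 ∤ c₃` from the kernel numeral
`∏ c_ℓ`, surj(3); NO tower / Manin on the UPPER side) or
`Assembly.bsdp_three_of_towerSurj_of_levelOneCertificates_of_baseRigidity_noRank_noEP` on the potentially
GOOD rows (tower and `3 ∤ ∏ c_ℓ` kernel-side), fed
* BY NAME from the landed S2 records of the same row: `surj3_v<label>` / `towerSurj3_v<label>`,
  `tamagawaProduct_v<label>` (observatory Tate-algorithm certificates), the point counts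
  `card_v<label>_<ℓ>`; `Addv W 3` (`3 ∣ Δ`, `3 ∣ c₄`) by `decide` on Cremona's coefficients;
* with NEW kernel numerics per row (CERTIFICATES): `natCard_threeTorsion_v<label>` — `#E(ℚ₃)[3] = 1` by
  n1011-p17's decider `LocalTorsion3.threeTorsionCheck` (`decide +kernel`; certificate `(k, cert)` found
  OUTSIDE the kernel by n1011-p17's `census/loc3t_cert2.py` sha16 03fc43299bcd03c2, run unchanged);
  `isKolyvaginProduct_one_v<label>` — `n = ℓ_a ℓ_b ∈ 𝒩₁(E,3)` from the two point counts;
  `forall_card_torsion_le_v<label>` — cyclicity `#Ẽ(𝔽_ℓ)[3] ≤ 3` at both level primes (by the count);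
* with EVIDENCE BINDERS per pair: the OPTIMAL datum at level `N` (`D`, `hopt`; Cremona `opt_man`: optimal,
  Manin constant `1`; `3 ∤ c_D` by Agashe–Ribet–Stein Thm. 2.6, `N ≤ 130000`), and `hδ` = THREE VALUES, each a
  HYPOTHESIS labelled EVIDENCE with the provenance stated here and per record (docstring discipline of n1011 lead
  GEN 8 R5-68 (i) / R5-84 (c)): (1) `δ̃_n(ψ) ≢ 0 (mod 3)` at the named level `(row, n)` — census-lead GEN 14 pass 52
  (CELL-PLAN A-216, 2026-08-21T21:42Z) WORD, quoted VERBATIM: 'TWO-SOURCE UNIT certificate class at (row, n): ENG-D engine 1 `goodlevel` (cc3_msadd 0.4.0; PARI-free a_n, hp period lattice) × engine 2 `goodmod` (cc3_mstw 0.6.0; PARI `ellan` a_n, PARI periods) in the §19.1 kit configuration (cc-eng-3, kit j139776, BLIND PASS 19/19), input-independent in-job — two implementations with distinct a_n sources and distinct period / modular-symbol code paths agree EXACTLY entry by entry on the x± tables at level n, hence on S_n and on the class v₃(δ̃_n) = 0 < k_n (UNIT), at the SAME pre-registered (row, n); the exact PARI `msfromell` arm concurs at 7/8 rows (20160z1 LISTED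 — exact side overflow at 28 GB per §19.1; its pair is e1 × e2); graded per n1011 R5-68 (i) — EVIDENCE / certificate tier, never a Literature fact; the records' conditional inputs stay displayed binders; nothing booked' — n1011 reading
  R5-81 (j) / R5-82 (b) / R5-84 (c); the SAME (row, n) carries p03's landed [K25]-conditional record in
  `Additive/X4ThreeKuriharaCertRecordsS2_39..42.lean`; (2) `δ̃_1 ≡ 0 (mod 3)` and (3) `δ̃_1 ≢ 0 (mod 27)`, i.e.
  `ord₃ [0]⁺ = 2` — PROVENANCE SENTENCE (n1011 lead GEN 8 R5-84 (c), quoted VERBATIM): 'Cremona allbsd L/Ω × kit x⁺(0), ENG-D e1 × e2 j139776; census pass 52: "x⁺(0) ord₃ = 2 on all arms"'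
  (`[0]⁺` and `L(E,1)/Ω_E` differ by `c_D = ±1` and `c_∞ ∈ {1, 2}`, units at `3`); no census grade is claimed for the
  level-one values beyond the quoted phrase.
Nothing is booked; class X4 stays CONSTRUCTION-SHAPED; N11's mark is unchanged.

References: C.-H. Kim, AJM 148 (2026) Thm. 1.9 (6), Thm. 3.13, §1.2.2 [Kim2022StructureSelmer];
K. Rubin, PCMI 18 (2011) Thm. 2.8.4 [Rubin2011]; B. Mazur, K. Rubin, Mem. AMS 799 (2004) [MazurRubin2004];
K. Kato, Astérisque 295 (2004) Thm. 14.5 (3) [Kato2004Asterisque]; D. Delbourgo (1998) Prop. 4 [Delbourgo1998];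
Agashe–Ribet–Stein (2006) Thm. 2.6 [AgasheRibetStein2006]; J. S. Milne, ADT (2006) I Thm. 2.8 [MilneADT2006];
J. H. Silverman, AEC (2009) VII.1, VII.5, X.4.14 [SilvermanAEC2009]; R. L. Miller, LMS JCM 14 (2011) Def. 1.1
[Miller2011LMS]; Cremona's tables [Cremona2006]; cell files cells/n1011/PLAN.md R5-81 (j) / R5-82 (b),
`class-closure/eng-3/out/e1good/j139776/KFOLD.tsv`, `b2b-bsdres-n1011-p03/KURIHARA-RECORDS-INDEX.tsv`.
-/

set_option autoImplicit false

noncomputable section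

open scoped Classical NumberField

open Function NumberField IsDedekindDomain WeierstrassCurve
  Literature.NumberTheory.EllipticCurves Literature.NumberTheory.EllipticCurves.ModularForms
  Literature.NumberTheory.EllipticCurves.Rank1Residual
  Literature.NumberTheory.EllipticCurves.AgasheRibetStein2006
  Literature.NumberTheory.EllipticCurves.Rank1Residual.X11RankOneCertificates
  Literature.NumberTheory.GaloisRepresentations
  Literature.NumberTheory.GaloisRepresentations.DiscreteGaloisModule Literature.NumberTheory.GaloisCohomology
  IsDedekindDomain.HeightOneSpectrum Rat.HeightOneSpectrum
  Summit.BirchSwinnertonDyer.BirchSwinnertonDyer.Rank1Residual.IntModel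
  Summit.BirchSwinnertonDyer.BirchSwinnertonDyer.Rank1Residual.X11RankOne
  Summit.BirchSwinnertonDyer.Rank1Residual.GaloisImage Summit.BirchSwinnertonDyer.Rank1Residual.X4

namespace Summit.BirchSwinnertonDyer.Rank1Residual.Additive.X4ThreeKuriharaCert

/-! ### END-m1 record: `20691e1` (`N = 20691`, potentially GOOD at `3`; `∏ c_ℓ = 8`, `#T = 2`, `#Ш_an = 9`), level `n = 43·79 = 3397` -/

/-- **`#E(ℚ₃)[3] = 1` for `20691e1` IN THE KERNEL** (class A1's `t = 0`; any globally minimal elliptic `W` with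
Cremona's integral model `[1, -1, 0, -258297, -50077648]`): n1011-p17's decider `LocalTorsion3.threeTorsionCheck` run by
`decide +kernel` on the certificate `k = 2`, `cert = []` (Hensel balls `(c, m, N, w)`; found
outside the kernel by n1011-p17's `census/loc3t_cert2.py` sha16 03fc43299bcd03c2, unchanged). A kernel CERTIFICATE, not evidence.
[cite: SilvermanAEC2009, VII.1 Remark 1.1 and VII.3 Prop. 3.1] -/
theorem natCard_threeTorsion_v20691e1 (W : WeierstrassCurve ℚ) [W.IsElliptic] [W.IsGloballyMinimal]
    (hI : integralModelInt W = ⟨1, -1, 0, -258297, -50077648⟩) :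
    Nat.card {Q : (W.baseChange ℚ_[3]).toAffine.Point // (3 : ℕ) • Q = 0} = 1 :=
  (LocalTorsion3.natCard_threeTorsion_eq_three_pow_zero_of_intModel_of_check 1 (-1) 0 (-258297) (-50077648) W hI
    (k := 2) (cert := []) (by decide +kernel)).trans (pow_zero 3)

/-- **`3397 = 43·79 ∈ 𝒩₁(20691e1, 3)` IN THE KERNEL** (both primes good, `≠ 3`, `≡ 1 (mod 3)`, `3 ∣ #Ẽ(𝔽_ℓ)`:
counts `48`, `84` — the landed `card_v20691e1_43`, `card_v20691e1_79` (`X4ThreeKuriharaCertRecordsS2_41`) reused by name).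
[cite: Kim2022StructureSelmer, §1.2.2 (PDF p. 4)] -/
theorem isKolyvaginProduct_one_v20691e1 {W : WeierstrassCurve ℚ} [W.IsElliptic] [W.IsGloballyMinimal]
    (hI : integralModelInt W = ⟨1, -1, 0, -258297, -50077648⟩) :
    haveI : Fact (Nat.Prime 3) := ⟨Nat.prime_three⟩
    Kato.IsKolyvaginProduct W 3 1 3397 := by
  haveI : Fact (Nat.Prime 3) := ⟨Nat.prime_three⟩
  haveI : Fact (Nat.Prime 43) := ⟨by norm_num⟩
  haveI : Fact (Nat.Prime 79) := ⟨by norm_num⟩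
  have h43 : Kato.IsKolyvaginPrime W 3 1 43 :=
    isKolyvaginPrime_of_intModel_of_card hI 3 1 43 (by norm_num) (by decide +kernel) (by decide)
      card_v20691e1_43 (by decide)
  have h79 : Kato.IsKolyvaginPrime W 3 1 79 :=
    isKolyvaginPrime_of_intModel_of_card hI 3 1 79 (by norm_num) (by decide +kernel) (by decide)
      card_v20691e1_79 (by decide)
  exact_mod_cast isKolyvaginProduct_mul h43 h79 (by norm_num)

/-- **Cyclicity `#Ẽ(𝔽_ℓ)[3] ≤ 3` at both primes of `3397 = 43·79` for `20691e1` IN THE KERNEL** (`43`: `9 ∤ 48` (count); `79`: `9 ∤ 84` (count)).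
[cite: SilvermanAEC2009, III.6.4 (b) and VII.3 Prop. 3.1] -/
theorem forall_card_torsion_le_v20691e1 {W : WeierstrassCurve ℚ} [W.IsGloballyMinimal]
    (hI : integralModelInt W = ⟨1, -1, 0, -258297, -50077648⟩) :
    ∀ (ℓ : ℕ) [Fact ℓ.Prime], ℓ ∣ 3397 →
      Nat.card {P : ((WeierstrassCurve.integralModelInt W).map
          (Int.castRingHom (ZMod ℓ))).toAffine.Point // 3 • P = 0} ≤ 3 := by
  haveI : Fact (Nat.Prime 43) := ⟨by norm_num⟩
  haveI : Fact (Nat.Prime 79) := ⟨by norm_num⟩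
  have c43 := card_torsion_le_of_intModel_of_card hI 3 43 card_v20691e1_43 (by decide)
  have c79 := card_torsion_le_of_intModel_of_card hI 3 79 card_v20691e1_79 (by decide)
  intro ℓ hℓ hdvd
  exact forall_card_torsion_le_of_dvd_mul 3 43 79 c43 c79 ℓ (by norm_num at hdvd ⊢; exact hdvd)

/-- **END-m1 RECORD `20691e1` at the level `n = 43·79 = 3397 ∈ 𝒩₁(E,3)` — [K25]-FREE, [S24]-FREE, no `hr`, no `hEP`;
CLOSES NOTHING, moves no mark** (`integralModelInt` currency: any globally minimal elliptic `W` with Cremona's integral model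
`[1, -1, 0, -258297, -50077648]`; `N = 20691`; ADDITIVE at `3` by `decide`; UPPER side (potentially GOOD): the `3`-adic tower (`towerSurj3_v20691e1`) and `3 ∤ ∏ c_ℓ = 8` (`tamagawaProduct_v20691e1`) kernel-side, optimal datum at `N ≤ 130000`; `#E(ℚ₃)[3] = 1`
(`natCard_threeTorsion_v20691e1`, kernel certificate); the level `3397 ∈ 𝒩₁` and cyclicity at `43, 79` IN THE KERNEL
(`isKolyvaginProduct_one_v20691e1`, `forall_card_torsion_le_v20691e1`)) ⟹ `BSD(E,3)` by
`Assembly.bsdp_three_of_towerSurj_of_levelOneCertificates_of_baseRigidity_noRank_noEP` (p302155). HYPOTHESES: the UPPER facts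
`hKatoS hDel hmodD hKatoχ`, `hGZK hmod h26`, `hCT`; the Poitou–Tate family `inv hperf hsum hcompl` (base rigidity: NO `hunro`),
the port `hPort` (FLAG `K22-Thm3.13-PORT@3`); EVIDENCE binders: the OPTIMAL datum `D`/`hopt` at level `20691` (Cremona `opt_man`),
and `hδ` = THREE VALUES, each a HYPOTHESIS labelled EVIDENCE: (1) `δ̃_{3397}(ψ) ≢ 0 (mod 3)` — census-lead GEN 14 pass 52 (A-216) WORD at this (row, n), quoted VERBATIM: 'TWO-SOURCE UNIT certificate class at (row, n): ENG-D engine 1 `goodlevel` (cc3_msadd 0.4.0; PARI-free a_n, hp period lattice) × engine 2 `goodmod` (cc3_mstw 0.6.0; PARI `ellan` a_n, PARI periods) in the §19.1 kit configuration (cc-eng-3, kit j139776, BLIND PASS 19/19), input-independent in-job — two implementations with distinct a_n sources and distinct period / modular-symbol code paths agree EXACTLY entry by entry on the x± tables at level n, hence on S_n and on the class v₃(δ̃_n) = 0 < k_n (UNIT), at the SAME pre-registered (row, n); the exact PARI `msfromell` arm concurs at 7/8 rows (20160z1 LISTED — exact side overflow at 28 GB per §19.1; its pair is e1 × e2); graded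 per n1011 R5-68 (i) — EVIDENCE / certificate tier, never a Literature fact; the records' conditional inputs stay displayed binders; nothing booked' (KFOLD.tsv of kit j139776: `δ̃_{3397} ≡ 2 (mod 3)` on e1 and on e2; n1011 reading R5-81 (j) / R5-82 (b) / R5-84 (c)); the SAME (row, n) as the landed [K25]-conditional record `bsdp3_kur_v20691e1` (`Additive/X4ThreeKuriharaCertRecordsS2_41`, p307534); (2) `δ̃_1 ≡ 0 (mod 3)` and
(3) `δ̃_1 ≢ 0 (mod 27)` (`ord₃ [0]⁺ = 2`) — PROVENANCE SENTENCE (n1011 lead GEN 8 R5-84 (c), quoted VERBATIM): 'Cremona allbsd L/Ω × kit x⁺(0), ENG-D e1 × e2 j139776; census pass 52: "x⁺(0) ord₃ = 2 on all arms"' — the numbers: Cremona `allbsd` `#Ш_an = 9`, `∏ c_ℓ = 8`, `#T = 2` ⟹ `ord₃ (L(E,1)/Ω_E) = ord₃ (9·8/2²) = 2`; kit j139776 level-zero field `x⁺(0) = 36` on e1 and on e2 (`H0` ✓; `c_∞ = 2`), `ord₃ = 2`. `r_an = 0` is NOT a binder (implied by (3) via p03's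
`analyticRank_eq_zero_of_kuriharaNumber_one_ne_zero` inside the END). DEBT REDUCTION, not coverage; nothing booked.
[cite: Kim2022StructureSelmer, Thm. 1.9 (6), Thm. 3.13 and §1.2.2] [cite: Rubin2011, Thm. 2.8.4]
[cite: Kato2004Asterisque, Thm. 14.5 (3) (p. 236)] [cite: Delbourgo1998, Prop. 4 (p. 144)]
[cite: AgasheRibetStein2006, Thm. 2.6 (p. 619)] [cite: MilneADT2006, I §2 Thm 2.8 (p. 31)]
[cite: SilvermanAEC2009, VII.5 Prop. 5.1 (c) and Thm. X.4.14] [cite: Miller2011LMS, §1 and Def. 1.1] -/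
theorem bsdp3_endm1_v20691e1
    -- UPPER half: the X4 chain of record; GZK; modularity; ARS 2.6; Cassels–Tate (NO [S24] fact)
    (hKatoS : Kato2004.rankZero_padicValNat_sha_le_sub_localTamagawa_of_additive_potGood_of_imageContainsSL2)
    (hDel : Delbourgo1998.prop4_rankZero_pow_dvd_constantCoeff)
    (hGZK : rank_eq_analyticRank_of_analyticRank_le_one) (hmod : hasEntireLFunction_rat)
    (hmodD : nonempty_modularParametrizationData)
    (hKatoχ : Wuthrich2014.kato_halfEigenCharIdeal_dvd_cyclotomicPrime_of_surjective)
    (h26 : cremona_abs_maninConstant_eq_one_of_level_le)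
    (hCT : exists_casselsTate_pairing (K := ℚ))
    -- the row
    {W : WeierstrassCurve ℚ} [W.IsElliptic] [W.IsGloballyMinimal]
    (hI : integralModelInt W = ⟨1, -1, 0, -258297, -50077648⟩)
    (D : ModularParametrizationData W 20691)
    (hopt : ∀ z ∈ D.L.lattice, ∃ w ∈ periodLattice D.f, z = D.c * w)
    -- LOWER half: the Poitou–Tate family at `3` (NO `hunro`, NO `hEP`), the ONE port
    (inv : LocalInvariants ℚ 3) (hperf : inv.IsPerfect) (hsum : inv.SumLocalTermEqZero)
    (hcompl : inv.SelmerComplement)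
    (v₃ : HeightOneSpectrum (𝓞 ℚ)) (hv₃ : ((3 : ℕ) : 𝓞 ℚ) ∈ v₃.asIdeal)
    (hPort : KatoKuriharaPortThreeAt W 0 v₃)
    -- the CERTIFICATE: THREE VALUES (EVIDENCE; provenance in the docstring)
    (hδ : ∃ (ψ : (ℓ : ℕ) → (ZMod ℓ)ˣ →* Multiplicative (ZMod (3 ^ 1)))
        (ψ₂₇ : (ℓ : ℕ) → (ZMod ℓ)ˣ →* Multiplicative (ZMod (3 ^ 3))),
      (∀ ℓ ∈ (3397 : ℕ).primeFactors, Function.Surjective (ψ ℓ)) ∧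
        kuriharaNumber D.f (3 ^ 1) 3397 ψ ≠ 0 ∧ kuriharaNumber D.f (3 ^ 1) 1 ψ = 0 ∧
        kuriharaNumber D.f (3 ^ 3) 1 ψ₂₇ ≠ 0) :
    BSDp W 3 := by
  haveI : Fact (Nat.Prime 3) := ⟨Nat.prime_three⟩
  haveI : NeZero (3397 : ℕ) := ⟨by norm_num⟩
  haveI : NeZero (20691 : ℕ) := ⟨by norm_num⟩
  obtain ⟨ψ, ψ₂₇, hψ, hcert, hzero₁, hunit₁⟩ := hδ
  exact Assembly.bsdp_three_of_towerSurj_of_levelOneCertificates_of_baseRigidity_noRank_noEP hKatoS hDel hGZK hmod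
    hmodD hKatoχ h26 hCT W hI (by decide +kernel) (by decide +kernel) (towerSurj3_v20691e1 hI)
    (natCard_threeTorsion_v20691e1 W hI) (by rw [tamagawaProduct_v20691e1 hI]; decide) (by norm_num) D hopt
    inv hperf hsum hcompl v₃ hv₃ hPort
    3397 (isKolyvaginProduct_one_v20691e1 hI) (forall_card_torsion_le_v20691e1 hI) ψ hψ hcert hzero₁ ψ₂₇ hunit₁

/-- **END-m1 RECORD `20691e1` on the LITERAL model `W = [1, -1, 0, -258297, -50077648]`** (`hI` from `hW` by `integralModelInt_eq_of_map_eq`;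
then `bsdp3_endm1_v20691e1`). Same HYPOTHESES / EVIDENCE binders / framing as `bsdp3_endm1_v20691e1`: [K25]-FREE, [S24]-FREE, no `hr`,
no `hEP`, THREE values in `hδ` each a HYPOTHESIS labelled EVIDENCE (provenance as in `bsdp3_endm1_v20691e1`); CLOSES NOTHING, moves no mark; nothing booked.
[cite: Kim2022StructureSelmer, Thm. 1.9 (6) and Thm. 3.13] [cite: SilvermanAEC2009, VII.1 Remark 1.1] -/
theorem bsdp3_endm1_v20691e1_of_eq
    -- UPPER half: the X4 chain of record; GZK; modularity; ARS 2.6; Cassels–Tate (NO [S24] fact)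
    (hKatoS : Kato2004.rankZero_padicValNat_sha_le_sub_localTamagawa_of_additive_potGood_of_imageContainsSL2)
    (hDel : Delbourgo1998.prop4_rankZero_pow_dvd_constantCoeff)
    (hGZK : rank_eq_analyticRank_of_analyticRank_le_one) (hmod : hasEntireLFunction_rat)
    (hmodD : nonempty_modularParametrizationData)
    (hKatoχ : Wuthrich2014.kato_halfEigenCharIdeal_dvd_cyclotomicPrime_of_surjective)
    (h26 : cremona_abs_maninConstant_eq_one_of_level_le)
    (hCT : exists_casselsTate_pairing (K := ℚ))
    -- the row (LITERAL model)
    (W : WeierstrassCurve ℚ) [W.IsElliptic] [W.IsGloballyMinimal]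
    (hW : W = ⟨1, -1, 0, -258297, -50077648⟩)
    (D : ModularParametrizationData W 20691)
    (hopt : ∀ z ∈ D.L.lattice, ∃ w ∈ periodLattice D.f, z = D.c * w)
    -- LOWER half: the Poitou–Tate family at `3` (NO `hunro`, NO `hEP`), the ONE port
    (inv : LocalInvariants ℚ 3) (hperf : inv.IsPerfect) (hsum : inv.SumLocalTermEqZero)
    (hcompl : inv.SelmerComplement)
    (v₃ : HeightOneSpectrum (𝓞 ℚ)) (hv₃ : ((3 : ℕ) : 𝓞 ℚ) ∈ v₃.asIdeal)
    (hPort : KatoKuriharaPortThreeAt W 0 v₃)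
    -- the CERTIFICATE: THREE VALUES (EVIDENCE; provenance in the docstring)
    (hδ : ∃ (ψ : (ℓ : ℕ) → (ZMod ℓ)ˣ →* Multiplicative (ZMod (3 ^ 1)))
        (ψ₂₇ : (ℓ : ℕ) → (ZMod ℓ)ˣ →* Multiplicative (ZMod (3 ^ 3))),
      (∀ ℓ ∈ (3397 : ℕ).primeFactors, Function.Surjective (ψ ℓ)) ∧
        kuriharaNumber D.f (3 ^ 1) 3397 ψ ≠ 0 ∧ kuriharaNumber D.f (3 ^ 1) 1 ψ = 0 ∧
        kuriharaNumber D.f (3 ^ 3) 1 ψ₂₇ ≠ 0) :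
    BSDp W 3 := by
  have hI : integralModelInt W = ⟨1, -1, 0, -258297, -50077648⟩ := by
    subst hW
    exact integralModelInt_eq_of_map_eq _ (map_mk_int 1 (-1) 0 (-258297) (-50077648))
  exact bsdp3_endm1_v20691e1 hKatoS hDel hGZK hmod hmodD hKatoχ h26 hCT hI D hopt inv hperf hsum hcompl v₃ hv₃
    hPort hδ

/-! ### END-m1 record: `20808k1` (`N = 20808`, (M): potentially MULTIPLICATIVE at `3`; `∏ c_ℓ = 8`, `#T = 2`, `#Ш_an = 9`), level `n = 37·61 = 2257` -/

/-- **`#E(ℚ₃)[3] = 1` for `20808k1` IN THE KERNEL** (class A1's `t = 0`; any globally minimal elliptic `W` with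
Cremona's integral model `[0, 0, 0, -136119, -19288438]`): n1011-p17's decider `LocalTorsion3.threeTorsionCheck` run by
`decide +kernel` on the certificate `k = 2`, `cert = [[6, 1, 3, 0]]` (Hensel balls `(c, m, N, w)`; found
outside the kernel by n1011-p17's `census/loc3t_cert2.py` sha16 03fc43299bcd03c2, unchanged). A kernel CERTIFICATE, not evidence.
[cite: SilvermanAEC2009, VII.1 Remark 1.1 and VII.3 Prop. 3.1] -/
theorem natCard_threeTorsion_v20808k1 (W : WeierstrassCurve ℚ) [W.IsElliptic] [W.IsGloballyMinimal]
    (hI : integralModelInt W = ⟨0, 0, 0, -136119, -19288438⟩) :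
    Nat.card {Q : (W.baseChange ℚ_[3]).toAffine.Point // (3 : ℕ) • Q = 0} = 1 :=
  (LocalTorsion3.natCard_threeTorsion_eq_three_pow_zero_of_intModel_of_check 0 0 0 (-136119) (-19288438) W hI
    (k := 2) (cert := [((6 : ℤ), 1, 3, 0)]) (by decide +kernel)).trans (pow_zero 3)

/-- **`2257 = 37·61 ∈ 𝒩₁(20808k1, 3)` IN THE KERNEL** (both primes good, `≠ 3`, `≡ 1 (mod 3)`, `3 ∣ #Ẽ(𝔽_ℓ)`:
counts `48`, `48` — the landed `card_v20808k1_37`, `card_v20808k1_61` (`X4ThreeKuriharaCertRecordsS2_42`) reused by name).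
[cite: Kim2022StructureSelmer, §1.2.2 (PDF p. 4)] -/
theorem isKolyvaginProduct_one_v20808k1 {W : WeierstrassCurve ℚ} [W.IsElliptic] [W.IsGloballyMinimal]
    (hI : integralModelInt W = ⟨0, 0, 0, -136119, -19288438⟩) :
    haveI : Fact (Nat.Prime 3) := ⟨Nat.prime_three⟩
    Kato.IsKolyvaginProduct W 3 1 2257 := by
  haveI : Fact (Nat.Prime 3) := ⟨Nat.prime_three⟩
  haveI : Fact (Nat.Prime 37) := ⟨by norm_num⟩
  haveI : Fact (Nat.Prime 61) := ⟨by norm_num⟩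
  have h37 : Kato.IsKolyvaginPrime W 3 1 37 :=
    isKolyvaginPrime_of_intModel_of_card hI 3 1 37 (by norm_num) (by decide +kernel) (by decide)
      card_v20808k1_37 (by decide)
  have h61 : Kato.IsKolyvaginPrime W 3 1 61 :=
    isKolyvaginPrime_of_intModel_of_card hI 3 1 61 (by norm_num) (by decide +kernel) (by decide)
      card_v20808k1_61 (by decide)
  exact_mod_cast isKolyvaginProduct_mul h37 h61 (by norm_num)

/-- **Cyclicity `#Ẽ(𝔽_ℓ)[3] ≤ 3` at both primes of `2257 = 37·61` for `20808k1` IN THE KERNEL** (`37`: `9 ∤ 48` (count); `61`: `9 ∤ 48` (count)).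
[cite: SilvermanAEC2009, III.6.4 (b) and VII.3 Prop. 3.1] -/
theorem forall_card_torsion_le_v20808k1 {W : WeierstrassCurve ℚ} [W.IsGloballyMinimal]
    (hI : integralModelInt W = ⟨0, 0, 0, -136119, -19288438⟩) :
    ∀ (ℓ : ℕ) [Fact ℓ.Prime], ℓ ∣ 2257 →
      Nat.card {P : ((WeierstrassCurve.integralModelInt W).map
          (Int.castRingHom (ZMod ℓ))).toAffine.Point // 3 • P = 0} ≤ 3 := by
  haveI : Fact (Nat.Prime 37) := ⟨by norm_num⟩
  haveI : Fact (Nat.Prime 61) := ⟨by norm_num⟩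
  have c37 := card_torsion_le_of_intModel_of_card hI 3 37 card_v20808k1_37 (by decide)
  have c61 := card_torsion_le_of_intModel_of_card hI 3 61 card_v20808k1_61 (by decide)
  intro ℓ hℓ hdvd
  exact forall_card_torsion_le_of_dvd_mul 3 37 61 c37 c61 ℓ (by norm_num at hdvd ⊢; exact hdvd)

/-- **END-m1 RECORD `20808k1` at the level `n = 37·61 = 2257 ∈ 𝒩₁(E,3)` — [K25]-FREE, [S24]-FREE, no `hr`, no `hEP`;
CLOSES NOTHING, moves no mark** (`integralModelInt` currency: any globally minimal elliptic `W` with Cremona's integral model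
`[0, 0, 0, -136119, -19288438]`; `N = 20808`; ADDITIVE at `3` by `decide`; UPPER side (M): surj(3) (`surj3_v20808k1`), `ord₃ j = 3·2 − 8 < 0` read off the model (`padicValRat_j_neg_of_intModel`), `3 ∤ c₃` from the kernel numeral `∏ c_ℓ = 8` (`tamagawaProduct_v20808k1`) — NO tower / Manin on the UPPER side; `#E(ℚ₃)[3] = 1`
(`natCard_threeTorsion_v20808k1`, kernel certificate); the level `2257 ∈ 𝒩₁` and cyclicity at `37, 61` IN THE KERNEL
(`isKolyvaginProduct_one_v20808k1`, `forall_card_torsion_le_v20808k1`)) ⟹ `BSD(E,3)` by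
`Assembly.bsdp_three_potMult_of_levelOneCertificates_of_baseRigidity_noRank_noEP` (p302155). HYPOTHESES: the UPPER facts
`hKatoS hDel hmodD hKatoχ`, `hGZK hmod h26`, `hCT`; the Poitou–Tate family `inv hperf hsum hcompl` (base rigidity: NO `hunro`),
the port `hPort` (FLAG `K22-Thm3.13-PORT@3`); EVIDENCE binders: the OPTIMAL datum `D`/`hopt` at level `20808` (Cremona `opt_man`),
and `hδ` = THREE VALUES, each a HYPOTHESIS labelled EVIDENCE: (1) `δ̃_{2257}(ψ) ≢ 0 (mod 3)` — census-lead GEN 14 pass 52 (A-216) WORD at this (row, n), quoted VERBATIM: 'TWO-SOURCE UNIT certificate class at (row, n): ENG-D engine 1 `goodlevel` (cc3_msadd 0.4.0; PARI-free a_n, hp period lattice) × engine 2 `goodmod` (cc3_mstw 0.6.0; PARI `ellan` a_n, PARI periods) in the §19.1 kit configuration (cc-eng-3, kit j139776, BLIND PASS 19/19), input-independent in-job — two implementations with distinct a_n sources and distinct period / modular-symbol code paths agree EXACTLY entry by entry on the x± tables at level n, hence on S_n and on the class v₃(δ̃_n) = 0 < k_n (UNIT), at the SAME pre-registered (row, n);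 the exact PARI `msfromell` arm concurs at 7/8 rows (20160z1 LISTED — exact side overflow at 28 GB per §19.1; its pair is e1 × e2); graded per n1011 R5-68 (i) — EVIDENCE / certificate tier, never a Literature fact; the records' conditional inputs stay displayed binders; nothing booked' (KFOLD.tsv of kit j139776: `δ̃_{2257} ≡ 1 (mod 3)` on e1 and on e2; n1011 reading R5-81 (j) / R5-82 (b) / R5-84 (c)); the SAME (row, n) as the landed [K25]-conditional record `bsdp3_kur_v20808k1` (`Additive/X4ThreeKuriharaCertRecordsS2_42`, p307749); (2) `δ̃_1 ≡ 0 (mod 3)` and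
(3) `δ̃_1 ≢ 0 (mod 27)` (`ord₃ [0]⁺ = 2`) — PROVENANCE SENTENCE (n1011 lead GEN 8 R5-84 (c), quoted VERBATIM): 'Cremona allbsd L/Ω × kit x⁺(0), ENG-D e1 × e2 j139776; census pass 52: "x⁺(0) ord₃ = 2 on all arms"' — the numbers: Cremona `allbsd` `#Ш_an = 9`, `∏ c_ℓ = 8`, `#T = 2` ⟹ `ord₃ (L(E,1)/Ω_E) = ord₃ (9·8/2²) = 2`; kit j139776 level-zero field `x⁺(0) = 36` on e1 and on e2 (`H0` ✓; `c_∞ = 2`), `ord₃ = 2`. `r_an = 0` is NOT a binder (implied by (3) via p03's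
`analyticRank_eq_zero_of_kuriharaNumber_one_ne_zero` inside the END). DEBT REDUCTION, not coverage; nothing booked.
[cite: Kim2022StructureSelmer, Thm. 1.9 (6), Thm. 3.13 and §1.2.2] [cite: Rubin2011, Thm. 2.8.4]
[cite: Kato2004Asterisque, Thm. 14.5 (3) (p. 236)] [cite: Delbourgo1998, Prop. 4 (p. 144)]
[cite: AgasheRibetStein2006, Thm. 2.6 (p. 619)] [cite: MilneADT2006, I §2 Thm 2.8 (p. 31)]
[cite: SilvermanAEC2009, VII.5 Prop. 5.1 (c) and Thm. X.4.14] [cite: Miller2011LMS, §1 and Def. 1.1] -/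
theorem bsdp3_endm1_v20808k1
    -- UPPER half: the X4 chain of record; GZK; modularity; ARS 2.6; Cassels–Tate (NO [S24] fact)
    (hKatoS : Kato2004.rankZero_padicValNat_sha_le_sub_localTamagawa_of_additive_potGood_of_imageContainsSL2)
    (hDel : Delbourgo1998.prop4_rankZero_pow_dvd_constantCoeff)
    (hGZK : rank_eq_analyticRank_of_analyticRank_le_one) (hmod : hasEntireLFunction_rat)
    (hmodD : nonempty_modularParametrizationData)
    (hKatoχ : Wuthrich2014.kato_halfEigenCharIdeal_dvd_cyclotomicPrime_of_surjective)
    (h26 : cremona_abs_maninConstant_eq_one_of_level_le)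
    (hCT : exists_casselsTate_pairing (K := ℚ))
    -- the row
    {W : WeierstrassCurve ℚ} [W.IsElliptic] [W.IsGloballyMinimal]
    (hI : integralModelInt W = ⟨0, 0, 0, -136119, -19288438⟩)
    (D : ModularParametrizationData W 20808)
    (hopt : ∀ z ∈ D.L.lattice, ∃ w ∈ periodLattice D.f, z = D.c * w)
    -- LOWER half: the Poitou–Tate family at `3` (NO `hunro`, NO `hEP`), the ONE port
    (inv : LocalInvariants ℚ 3) (hperf : inv.IsPerfect) (hsum : inv.SumLocalTermEqZero)
    (hcompl : inv.SelmerComplement)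
    (v₃ : HeightOneSpectrum (𝓞 ℚ)) (hv₃ : ((3 : ℕ) : 𝓞 ℚ) ∈ v₃.asIdeal)
    (hPort : KatoKuriharaPortThreeAt W 0 v₃)
    -- the CERTIFICATE: THREE VALUES (EVIDENCE; provenance in the docstring)
    (hδ : ∃ (ψ : (ℓ : ℕ) → (ZMod ℓ)ˣ →* Multiplicative (ZMod (3 ^ 1)))
        (ψ₂₇ : (ℓ : ℕ) → (ZMod ℓ)ˣ →* Multiplicative (ZMod (3 ^ 3))),
      (∀ ℓ ∈ (2257 : ℕ).primeFactors, Function.Surjective (ψ ℓ)) ∧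
        kuriharaNumber D.f (3 ^ 1) 2257 ψ ≠ 0 ∧ kuriharaNumber D.f (3 ^ 1) 1 ψ = 0 ∧
        kuriharaNumber D.f (3 ^ 3) 1 ψ₂₇ ≠ 0) :
    BSDp W 3 := by
  haveI : Fact (Nat.Prime 3) := ⟨Nat.prime_three⟩
  haveI : NeZero (2257 : ℕ) := ⟨by norm_num⟩
  haveI : NeZero (20808 : ℕ) := ⟨by norm_num⟩
  obtain ⟨ψ, ψ₂₇, hψ, hcert, hzero₁, hunit₁⟩ := hδ
  exact Assembly.bsdp_three_potMult_of_levelOneCertificates_of_baseRigidity_noRank_noEP hKatoS hDel hGZK hmod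
    hmodD hKatoχ h26 hCT W hI (by decide +kernel) (by decide +kernel) (by exact_mod_cast surj3_v20808k1 hI)
    (padicValRat_j_neg_of_intModel hI 3 2 (by decide) (by decide))
    (by
      intro h3
      have h := h3.trans (localTamagawaNumber_padic_dvd_tamagawaProduct W 3)
      rw [tamagawaProduct_v20808k1 hI] at h
      exact absurd h (by decide))
    (natCard_threeTorsion_v20808k1 W hI) (by norm_num) D hopt inv hperf hsum hcompl v₃ hv₃ hPort
    2257 (isKolyvaginProduct_one_v20808k1 hI) (forall_card_torsion_le_v20808k1 hI) ψ hψ hcert hzero₁ ψ₂₇ hunit₁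

/-- **END-m1 RECORD `20808k1` on the LITERAL model `W = [0, 0, 0, -136119, -19288438]`** (`hI` from `hW` by `integralModelInt_eq_of_map_eq`;
then `bsdp3_endm1_v20808k1`). Same HYPOTHESES / EVIDENCE binders / framing as `bsdp3_endm1_v20808k1`: [K25]-FREE, [S24]-FREE, no `hr`,
no `hEP`, THREE values in `hδ` each a HYPOTHESIS labelled EVIDENCE (provenance as in `bsdp3_endm1_v20808k1`); CLOSES NOTHING, moves no mark; nothing booked.
[cite: Kim2022StructureSelmer, Thm. 1.9 (6) and Thm. 3.13] [cite: SilvermanAEC2009, VII.1 Remark 1.1] -/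
theorem bsdp3_endm1_v20808k1_of_eq
    -- UPPER half: the X4 chain of record; GZK; modularity; ARS 2.6; Cassels–Tate (NO [S24] fact)
    (hKatoS : Kato2004.rankZero_padicValNat_sha_le_sub_localTamagawa_of_additive_potGood_of_imageContainsSL2)
    (hDel : Delbourgo1998.prop4_rankZero_pow_dvd_constantCoeff)
    (hGZK : rank_eq_analyticRank_of_analyticRank_le_one) (hmod : hasEntireLFunction_rat)
    (hmodD : nonempty_modularParametrizationData)
    (hKatoχ : Wuthrich2014.kato_halfEigenCharIdeal_dvd_cyclotomicPrime_of_surjective)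
    (h26 : cremona_abs_maninConstant_eq_one_of_level_le)
    (hCT : exists_casselsTate_pairing (K := ℚ))
    -- the row (LITERAL model)
    (W : WeierstrassCurve ℚ) [W.IsElliptic] [W.IsGloballyMinimal]
    (hW : W = ⟨0, 0, 0, -136119, -19288438⟩)
    (D : ModularParametrizationData W 20808)
    (hopt : ∀ z ∈ D.L.lattice, ∃ w ∈ periodLattice D.f, z = D.c * w)
    -- LOWER half: the Poitou–Tate family at `3` (NO `hunro`, NO `hEP`), the ONE port
    (inv : LocalInvariants ℚ 3) (hperf : inv.IsPerfect) (hsum : inv.SumLocalTermEqZero)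
    (hcompl : inv.SelmerComplement)
    (v₃ : HeightOneSpectrum (𝓞 ℚ)) (hv₃ : ((3 : ℕ) : 𝓞 ℚ) ∈ v₃.asIdeal)
    (hPort : KatoKuriharaPortThreeAt W 0 v₃)
    -- the CERTIFICATE: THREE VALUES (EVIDENCE; provenance in the docstring)
    (hδ : ∃ (ψ : (ℓ : ℕ) → (ZMod ℓ)ˣ →* Multiplicative (ZMod (3 ^ 1)))
        (ψ₂₇ : (ℓ : ℕ) → (ZMod ℓ)ˣ →* Multiplicative (ZMod (3 ^ 3))),
      (∀ ℓ ∈ (2257 : ℕ).primeFactors, Function.Surjective (ψ ℓ)) ∧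
        kuriharaNumber D.f (3 ^ 1) 2257 ψ ≠ 0 ∧ kuriharaNumber D.f (3 ^ 1) 1 ψ = 0 ∧
        kuriharaNumber D.f (3 ^ 3) 1 ψ₂₇ ≠ 0) :
    BSDp W 3 := by
  have hI : integralModelInt W = ⟨0, 0, 0, -136119, -19288438⟩ := by
    subst hW
    exact integralModelInt_eq_of_map_eq _ (map_mk_int 0 0 0 (-136119) (-19288438))
  exact bsdp3_endm1_v20808k1 hKatoS hDel hGZK hmod hmodD hKatoχ h26 hCT hI D hopt inv hperf hsum hcompl v₃ hv₃
    hPort hδ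

end Summit.BirchSwinnertonDyer.Rank1Residual.Additive.X4ThreeKuriharaCert

end
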